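import Literature.MathematicalPhysics.QuantumFieldTheory.Balaban1983to89.Node00.Record7
import Literature.MathematicalPhysics.QuantumFieldTheory.Balaban1983to89.Node00.BackgroundActionOfRecord
import Literature.MathematicalPhysics.QuantumFieldTheory.Balaban1983to89.Node00.BetaOfRecord

/-!
# NODE 00 (YM-PLAN Track A) — STAGE 8 OF THE RECORD CHAIN: `IsRecordOfRecord₈C` — the Stage-7 record (C-binding) WHOSE β-functions, background Wilson
# action `A^η(U_k(V))`, effective action `A_k`, expansion term `𝐄_k` and [I]-side format predicates `ReprA ∕ IndA` ARE the objects of record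
# (`Node00/BetaOfRecord.lean`, `Node00/BackgroundActionOfRecord.lean`); refinement `IsRecordOfRecord₈C → IsRecordOfRecord₇C → IsRecordOfRecord₅C`

NODE 00 STAGE-8 MODULE (seat `pub-ymgap-node00-def`; assembles the dedicated definer `pub-ymgap-node00-def-B`'s `Node00/BackgroundActionOfRecord.lean` (U_k by the
[B11] Thm-1 minimiser in chair R434 (c2)'s `Classical.choose` idiom; `A_k` by the printed recursion (0.17)–(0.19) [I] via `B12Eq019ActionBody`; `𝐄_k` by (0.22) read as
its definition; `ReprA`, `IndA`) and dag-n09-b's `Node00/BetaOfRecord.lean` (β as the second moment of the polarisation of the MERGED new term (1.6) [I] —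
`betaMerged` — in the split-compatible convention of record `betaOfMerged βm (beta0OfMerged βm v₀) γ`, chair R434 (c3)'s `limUnder` reading for β⁰), with the
assembler's seven field equations certified by def-B (`probe_assembly_tree.lean` 972f417cbb3caf44), per DEFINER-SPEC-g28.md §1.
THE RESIDUAL AFTER THIS STAGE: the (2.18) format predicate `S218` (stage ₆), the (0.2) representation extraction `rep` (stage ₇b), the per-run fluctuation
inputs `Efl ∕ logz` of the parametric `EOfRecord` (until `ENormOfRecord` of def-R's FILE 3 replaces them), the [B8]–[B16] carrier families (Stages 3′∕4), and the
free scalar fields of the binding world.  NEW parameters: the background regularity radius `εbg` of (0.21) [I], and the β-layer's Lie-algebra chart data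
(`Vβ`, `ιβ`, `ρ8 : Vβ →L[ℝ] M_N(ℂ)`, a basis `bV`, the base histories `v₀` at which β⁰ is read).
HONEST FRAMING: definitions + kernel bookkeeping; no estimate, no satisfiability; nothing of Bałaban's asserted; one finite T⁴ — NOT ℝ⁴ ∕ OS ∕ mass gap ∕ Clay.
-/

noncomputable section

open MeasureTheory
open scoped Matrix.Norms.L2Operator

namespace Literature.MathematicalPhysics.QuantumFieldTheory.Balaban1983to89.Node00

open T4Continuum AveragingRT T4FiniteEpsInhabited FlowStep FlowStepRuns DagBinding T4DatumAssembly

/-! ## §1. Stage-8 parameters -/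

/-- **Stage-8 family parameters**: the Stage-7 parameters, the background regularity radius `εbg` of [Balaban1987RG1] (0.21), and the β-layer's chart data — a real
normed space `Vβ` with a finite basis `bV` and a continuous linear map `ρ8 : Vβ → M_N(ℂ)` (the Lie-algebra directions along which the Hessian (1.20) is read), and the base
histories `v₀ k` at which the one-loop coefficient β⁰_k is read (`beta0OfMerged`). [cite: Balaban1987RG1, (0.21) p.256 and (1.20)–(1.22) p.264 (parameter dictionary)] -/
structure Stage8Params (Fam : T4Family) (N : ℕ) [NeZero N] extends Stage7Params Fam N where
  /-- the regularity radius `ε` of the background domain (0.21) -/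
  εbg : ℝ
  /-- the β-layer's direction space -/
  Vβ : Type
  [instVβ₁ : NormedAddCommGroup Vβ]
  [instVβ₂ : NormedSpace ℝ Vβ]
  /-- index type of its basis -/
  ιβ : Type
  [instιβ : Fintype ιβ]
  /-- the chart `Vβ → M_N(ℂ)` -/
  ρ8 : Vβ →L[ℝ] Matrix (Fin N) (Fin N) ℂ
  /-- a basis of `Vβ` -/
  bV : Module.Basis ιβ ℝ Vβ
  /-- base histories for β⁰ -/
  v₀ : (k : ℕ) → (Fin (k + 1) → ℝ)

-- NO global instance attribute on the carried instances (typer lint); they are re-introduced locally with `letI` where needed.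

variable (F : T4Family) (N : ℕ) [NeZero N]

/-- Admissibility at Stage 8 = Stage-7 admissibility ∧ `0 < εbg` (non-empty background regularity class). NO clause on a residual object.
[cite: Balaban1987RG1, (0.21) p.256 (hypothesis dictionary)] -/
def Stage8Params.Admissible (θ : Stage8Params F N) : Prop :=
  θ.toStage7Params.Admissible ∧ 0 < θ.εbg

/-- def-R's χ re-keyed per torus and coupling sequence — the slot def-B's `effActionH` consumes. [cite: Balaban1988Convergent, (2.17) p.257 (bookkeeping)] -/
def chi7 (θ : Stage8Params F N) (K : ℕ) (g : ℕ → ℝ) (k : ℕ) : Density (F.P K) k (SU N) :=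
  chiOfRecord F N θ.ν g K k

/-- **The β-functions of record at `θ`** ([Balaban1987RG1] (1.20)–(1.22) read on the MERGED new term (1.6); split-compatible off-box convention):
`betaOfMerged βm (beta0OfMerged βm v₀) γ` with `βm := betaMerged F (mergedTermFamilyMat F N χ₇ εbg) ρ8 bV` (def-B's certified line). [cite: Balaban1987RG1, (1.20)–(1.22) p.264] -/
def betaOfRecord₈ (θ : Stage8Params F N) : HBeta :=
  letI := θ.instVβ₁; letI := θ.instVβ₂; letI := θ.instιβ
  betaOfMerged (betaMerged F (mergedTermFamilyMat F N (chi7 F N θ) θ.εbg) θ.ρ8 θ.bV)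
    (beta0OfMerged (betaMerged F (mergedTermFamilyMat F N (chi7 F N θ) θ.εbg) θ.ρ8 θ.bV) θ.v₀) θ.γ

/-- **The Stage-8 residual**: the Stage-5 residual with `βfun := betaOfRecord₈ θ` and — at THAT β's forward-generated couplings — def-R's `χ ∕ dom ∕ E ∕ R` (as at
Stage 7) and def-B's `wilsonBG ∕ effAction ∕ Ek ∕ ReprA ∕ IndA`. [cite: Balaban1987RG1, (0.17)–(0.22) pp.255–256 and (1.20)–(1.22) p.264; Balaban1988Convergent, (2.16)–(2.17) p.257, (1.15) p.249; Balaban1989LargeFieldI, (0.3)–(0.4) p.176 (the objects substituted)] -/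
def residualOfStage8 (θ : Stage8Params F N) : Residual₅ F N :=
  { θ.res with
    βfun := betaOfRecord₈ F N θ
    χ := fun p k => chiOfRecord F N θ.ν (genSeq (betaOfRecord₈ F N θ) p.g0) p.K k
    dom := fun p k => domAltOfRecord F N θ.ν p.K k
    E := EOfRecord F N θ.ν θ.Efl θ.logz (fun p => genSeq (betaOfRecord₈ F N θ) p.g0)
    R := ROp03OfRecord F N θ.rep
    preservesIntegral_R := preservesIntegral_ROp03OfRecord F N θ.rep
    integrable_R := integrable_ROp03OfRecord F N θ.rep
    wilsonBG := wilsonBGOfRecord F N θ.εbg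
    effAction := effActionOfRecord F N (chi7 F N θ) (betaOfRecord₈ F N θ)
    Ek := EkOfRecord F N (chi7 F N θ) θ.εbg (betaOfRecord₈ F N θ)
    ReprA := ReprAOfRecord F N (chi7 F N θ) θ.εbg (betaOfRecord₈ F N θ)
    IndA := IndAOfRecord F N (chi7 F N θ) θ.εbg (betaOfRecord₈ F N θ) }

/-- The Stage-7 WITNESS of a Stage-8 parameter: the Stage-7 parameters with `βfun` and the five action∕format fields of `res` replaced by the objects of record
(the fields `residualOfStage7` does not overwrite) — so that `residualOfStage7` of the witness IS `residualOfStage8 θ` (`rfl`). [cite: Balaban1987RG1, (0.22) p.256 (bookkeeping)] -/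
def Stage8Params.toStage7W (θ : Stage8Params F N) : Stage7Params F N :=
  { θ.toStage7Params with
    res := { θ.res with
      βfun := betaOfRecord₈ F N θ
      wilsonBG := wilsonBGOfRecord F N θ.εbg
      effAction := effActionOfRecord F N (chi7 F N θ) (betaOfRecord₈ F N θ)
      Ek := EkOfRecord F N (chi7 F N θ) θ.εbg (betaOfRecord₈ F N θ)
      ReprA := ReprAOfRecord F N (chi7 F N θ) θ.εbg (betaOfRecord₈ F N θ)
      IndA := IndAOfRecord F N (chi7 F N θ) θ.εbg (betaOfRecord₈ F N θ) } }

/-- `residualOfStage7 (toStage7W θ) = residualOfStage8 θ` (`rfl`). [cite: Balaban1987RG1, (0.22) p.256 (bookkeeping)] -/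
theorem residualOfStage7_toStage7W (θ : Stage8Params F N) :
    residualOfStage7 F N (θ.toStage7W F N) = residualOfStage8 F N θ := rfl

/-- The Stage-5 view of Stage-8 parameters. [cite: Balaban1989LargeFieldI, (0.2) p.176 (bookkeeping)] -/
def Stage8Params.toStage5 (θ : Stage8Params F N) : Stage5Params F N :=
  { θ.toStage5Params with res := residualOfStage8 F N θ }

/-- The Stage-5 view factors through the Stage-7 witness (`rfl`). [cite: Balaban1989LargeFieldI, (0.2) p.176 (bookkeeping)] -/
theorem Stage8Params.toStage5_eq (θ : Stage8Params F N) : θ.toStage5 F N = (θ.toStage7W F N).toStage5 F N := rfl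

/-- Re-lettering the interval constant of Stage-5 parameters does not change the density tower (it reads the residual only; induction on `k`).
[cite: Balaban1988Convergent, (0.2) p.244 (bookkeeping)] -/
theorem densOfRecord₅_reletter (θ₅ : Stage5Params F N) (γ' : ℝ) (p : B12.RunParams) :
    ∀ k, densOfRecord₅ F N { θ₅ with γ := γ' } p k = densOfRecord₅ F N θ₅ p k
  | 0 => rfl
  | k + 1 => by
    show θ₅.res.R p k (TrhoOfRecord F N p.K k (densOfRecord₅ F N { θ₅ with γ := γ' } p k)) =
      θ₅.res.R p k (TrhoOfRecord F N p.K k (densOfRecord₅ F N θ₅ p k))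
    rw [densOfRecord₅_reletter θ₅ γ' p k]

/-- … nor the machine of the record (every field reads the residual; the §2-form slot through the density tower). [cite: Balaban1988Convergent, (0.2) p.244 (bookkeeping)] -/
theorem machineOfRecord₅_reletter (θ₅ : Stage5Params F N) (γ' : ℝ) : machineOfRecord₅ F N { θ₅ with γ := γ' } = machineOfRecord₅ F N θ₅ := by
  unfold machineOfRecord₅
  simp only [densOfRecord₅_reletter]

/-- … nor, therefore, the assembled datum. [cite: Balaban1988Convergent, (0.2) p.244 (bookkeeping)] -/
theorem datumOfRecord₅_reletter (θ₅ : Stage5Params F N) (γ' : ℝ) : datumOfRecord₅ F N { θ₅ with γ := γ' } = datumOfRecord₅ F N θ₅ := by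
  unfold datumOfRecord₅
  rw [machineOfRecord₅_reletter]

/-- … nor the upstream block of record (it reads the Stage-3 dictionary and the residual carriers only; `rfl`). [cite: Balaban1985UV3, Thm 1 p.257 (bookkeeping)] -/
theorem upOfRecord₅C_reletter (θ₅ : Stage5Params F N) (γ' : ℝ) (P : B12.RunParams) :
    upOfRecord₅C F N { θ₅ with γ := γ' } P = upOfRecord₅C F N θ₅ P := rfl

/-- The Stage-5 view of the re-lettered Stage-7 witness is the re-lettered Stage-5 view (`rfl`). [cite: Balaban1989LargeFieldI, (0.2) p.176 (bookkeeping)] -/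
theorem Stage8Params.toStage5_reletter (θ : Stage8Params F N) (γ' : ℝ) :
    Stage7Params.toStage5 F N { θ.toStage7W F N with γ := γ' } = { θ.toStage5 F N with γ := γ' } := rfl

/-! ## §2. The Stage-8 record predicate (C-binding) and its refinements -/

/-- **«(D, w) is the record, Stage 8»** (C-binding): a record in the sense of `IsRecordOfRecord₅C` at parameters whose residual carries the β-functions, χ, dom, E, R,
A^η(U_k), A_k, 𝐄_k, ReprA, IndA OF RECORD.  THE γ-CLAUSE IS `0 < w.γ ∧ w.γ ≤ θ.γ` (b2b t4-dagwriter g81's certified remedy (B′)): at this stage the datum READS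
`θ.γ` — it is the radius of the history box on which the β of record IS the merged β (`betaOfMerged … θ.γ`) — so the binding world's small-coupling window `]0, w.γ]`
must lie INSIDE that box, not coincide with its edge; with `=` the record class would not be closed under γ-lowering (the route's re-lettering glue), with `≤` it is,
by the same witness.  At Stages 5∕7 (datum independent of γ) the two clauses give the same class up to the witness's letter. [cite: Balaban1987RG1, (0.17)–(0.24) pp.255–257, (1.20)–(1.22) p.264, Thm 3 p.264; Balaban1988Convergent, (2.16)–(2.17) p.257, Thm 1 p.262; Balaban1989LargeFieldI, (0.2)–(0.4) p.176; Balaban1985Variational, Thm 1 p.279 (objects of record, Stage 8 dictionary)] -/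
def IsRecordOfRecord₈C (D : FiniteEpsData F (SU N)) (w : WorldP) : Prop :=
  ∃ θ : Stage8Params F N, θ.Admissible ∧ D = datumOfRecord₅ F N (θ.toStage5 F N) ∧ w.C = D.C ∧ (0 < w.γ ∧ w.γ ≤ θ.γ) ∧ w.L = (θ.L : ℝ) ∧
    ∀ P : B12.RunParams, w.up P = upOfRecord₅C F N (θ.toStage5 F N) P

variable {F N}

/-- **Refinement `IsRecordOfRecord₈C → IsRecordOfRecord₇C`** (witness: `toStage7W` RE-LETTERED to the world's own `γ` — the Stage-7 datum and upstream block do not read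
`γ`, so they are unchanged (`rfl`); admissibility is Stage 7's with `0 < w.γ`). [cite: Balaban1987RG1, (0.22) p.256 (bookkeeping)] -/
theorem isRecordOfRecord₇C_of_isRecordOfRecord₈C {D : FiniteEpsData F (SU N)} {w : WorldP} (h : IsRecordOfRecord₈C F N D w) :
    IsRecordOfRecord₇C F N D w := by
  obtain ⟨θ, hθ, hD, hC, ⟨hγ0, -⟩, hL, hup⟩ := h
  refine ⟨{ θ.toStage7W F N with γ := w.γ }, ⟨⟨hθ.1.1.1, hγ0⟩, hθ.1.2⟩, ?_, hC, rfl, hL, fun P => ?_⟩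
  · rw [Stage8Params.toStage5_reletter, datumOfRecord₅_reletter]; exact hD
  · rw [Stage8Params.toStage5_reletter, upOfRecord₅C_reletter]; exact hup P

/-- Refinement down to the record predicate of record. [cite: Balaban1989LargeFieldI, (0.2) p.176 (bookkeeping)] -/
theorem isRecordOfRecord₅C_of_isRecordOfRecord₈C {D : FiniteEpsData F (SU N)} {w : WorldP} (h : IsRecordOfRecord₈C F N D w) :
    IsRecordOfRecord₅C F N D w :=
  isRecordOfRecord₅C_of_isRecordOfRecord₇C (isRecordOfRecord₇C_of_isRecordOfRecord₈C h)

/-! ## §3. The objects of a Stage-8 record, unfolded (the faces n13-b's regression reads) -/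

variable (F N)

/-- At Stage 8 the datum's β-functions ARE `betaOfRecord₈ θ` (`rfl`). [cite: Balaban1987RG1, (1.20)–(1.22) p.264 (bookkeeping)] -/
theorem βfun_stage8 (θ : Stage8Params F N) : (datumOfRecord₅ F N (θ.toStage5 F N)).βfun = betaOfRecord₈ F N θ := rfl

/-- Hence the couplings of every run are generated FORWARD by (0.20) with the β of record (`rfl`). [cite: Balaban1987RG1, (0.17)–(0.20) pp.255–256 (bookkeeping)] -/
theorem flow_stage8 (θ : Stage8Params F N) (p : B12.RunParams) :
    ((datumOfRecord₅ F N (θ.toStage5 F N)).C p).flow = genFlow (betaOfRecord₈ F N θ) p.g0 := rfl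

/-- The β of record CARRIES the one-loop split with `β⁰ = beta0OfMerged …` BY CONSTRUCTION (`oneLoopSplit_betaOfMerged`) — the structure, not the asymptotic-freedom
estimate `β⁰ > 0` (NODE O's). [cite: Balaban1987RG1, (1.22) p.264 and p.268 (2.12)–(2.14) (the printed split; bookkeeping)] -/
def oneLoopSplit_stage8 (θ : Stage8Params F N) : B12Beta.OneLoopSplit (betaOfRecord₈ F N θ) := by
  unfold betaOfRecord₈
  exact oneLoopSplit_betaOfMerged _ _ _

/-- At Stage 8 the background Wilson action IS def-B's `wilsonBGOfRecord` (`rfl`). [cite: Balaban1987RG1, (0.22) p.256 (bookkeeping)] -/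
theorem wilsonBG_stage8 (θ : Stage8Params F N) (p : B12.RunParams) (k : ℕ) :
    ((datumOfRecord₅ F N (θ.toStage5 F N)).C p).wilsonBG k = wilsonBGOfRecord F N θ.εbg p k := rfl

/-- At Stage 8 the effective action IS def-B's `effActionOfRecord` at the β of record (`rfl`). [cite: Balaban1987RG1, (0.17)–(0.19) pp.255–256 (bookkeeping)] -/
theorem effAction_stage8 (θ : Stage8Params F N) (p : B12.RunParams) (k : ℕ) :
    ((datumOfRecord₅ F N (θ.toStage5 F N)).C p).effAction k = effActionOfRecord F N (chi7 F N θ) (betaOfRecord₈ F N θ) p k := rfl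

/-- At Stage 8 the χ of the construction IS def-R's `chiOfRecord` at the β of record's couplings (`rfl`). [cite: Balaban1988Convergent, (2.17) p.257 (bookkeeping)] -/
theorem chi_stage8 (θ : Stage8Params F N) (p : B12.RunParams) (k : ℕ) :
    ((datumOfRecord₅ F N (θ.toStage5 F N)).C p).χ k = chiOfRecord F N θ.ν (genSeq (betaOfRecord₈ F N θ) p.g0) p.K k := rfl

/-- At Stage 8 the clause `IndAss p k` IS def-B's `IndAOfRecord` read at the generated history and the record's objects (`Iff.rfl`). [cite: Balaban1987RG1, (1.1)–(1.6) pp.260–261 and Thm 3 p.264 (bookkeeping)] -/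
theorem indAss_stage8_iff (θ : Stage8Params F N) (p : B12.RunParams) (k : ℕ) :
    ((datumOfRecord₅ F N (θ.toStage5 F N)).C p).IndAss k ↔
      IndAOfRecord F N (chi7 F N θ) θ.εbg (betaOfRecord₈ F N θ) p k (prefixOf (genSeq (betaOfRecord₈ F N θ) p.g0) k)
        (domAltOfRecord F N θ.ν p.K k) (effActionOfRecord F N (chi7 F N θ) (betaOfRecord₈ F N θ) p k)
        (wilsonBGOfRecord F N θ.εbg p k) (EkOfRecord F N (chi7 F N θ) θ.εbg (betaOfRecord₈ F N θ) p k) := Iff.rfl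

end Literature.MathematicalPhysics.QuantumFieldTheory.Balaban1983to89.Node00

end
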